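import Summits.AtomisticToContinuum.BoseEinsteinCondensation.Theses.BECStronglyRayleigh
import Summits.AtomisticToContinuum.BoseEinsteinCondensation.Theorems.InsertionFieldDelocalisation.Negative.Toolkit
import Summits.AtomisticToContinuum.BoseEinsteinCondensation.Theorems.InsertionFieldDelocalisation.Negative.Tightness
import HarnessLib

/-!
# PO averaging, deterministic part: the mixture decompositions of the insertion fields of the
# Penrose–Onsager vector and the Jensen bound for the flatness functional
# (helper for stub `stub_poAveraging` of line `cosh-budget-penrose-onsager`, crux
# `BECStronglyRayleigh.InsertionFieldDelocalisation`, stmt-AtomisticToContinuum-9673)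

Conventions of `Theorems/InsertionFieldDelocalisation/Negative/Toolkit.lean`: occupation indicators
`1_S = fun z => if z ∈ S then 0 else 1` (occupied = index `0`), the two-particle insertion field
`field ψ T x = Σ_y [x ∉ T, y ∉ T, x ≠ y] Re ψ(1_{T ∪ {x,y}})`, the flatness functional
`K1lhs r = Σr³/Σr + (Σr²)²/(Σr)²`. The one-particle field is written out,
`u^T_x = [x ∉ T] Re ψ(1_{T ∪ x})`, and the Penrose–Onsager (PO) vector of `ψ` is
`Φ = A†ψ : σ ↦ Σ_{x : σ_x = 0} ψ(σ with x emptied)` (`Function.update σ x 1`).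

* `cb2po_poVec_ind` : `Φ(1_S) = Σ_{u ∈ S} ψ(1_{S ∖ u})`.
* `cb2po_field1_poVec` : `u^T[Φ]_x = Re ψ(1_T) + Σ_{z ∈ T} u^{T ∖ z}[ψ]_x` (`x ∉ T`): the one-particle
  field of `Φ` is a positive mixture of a flat field and of one-particle fields of `ψ`.
* `cb2po_field_poVec` : `r^T[Φ]_x = (Σ_y u^T[ψ]_y) + (|Λ| - 2|T| - 2)·u^T[ψ]_x + Σ_{z ∈ T} r^{T ∖ z}[ψ]_x`
  (`x ∉ T`): flat + one-particle + two-particle fields of `ψ` on the deleted backgrounds. Both are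
  unconditional finite identities (no sector or eigen-equation hypothesis).
* `cb2po_K1lhs_mixture_le` : for a positive mixture `R = Σ_k r_k` of nonnegative fields,
  `K1lhs R ≤ Σ_k (‖R‖₁/‖r_k‖₁) K1lhs r_k` (Jensen with the mass fractions as weights; equality for
  parallel components): flatness of a mixture ≤ mass-weighted flatness of its components.
* `cb2po_poVec_nonneg`; `stub_poAveragingDecomposition` : the registered sub-goal (torus form).
-/

noncomputable section

open scoped BigOperators ComplexOrder
open Literature.MathematicalPhysics.QuantumLattice Literature.Probability.LatticeModels Matrix Finset
open Summit.AtomisticToContinuum.BoseEinsteinCondensation.Theses.BECStronglyRayleigh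
open Summit.AtomisticToContinuum.BoseEinsteinCondensation.Theorems.InsertionFieldDelocalisation.Negative

namespace Summit.AtomisticToContinuum.BoseEinsteinCondensation.Cruxes.InsertionFieldDelocalisation.CoshBudgetPenroseOnsager

section Bookkeeping

variable {Λ : Type*} [DecidableEq Λ]

/-- Emptying the site `x` of the occupation indicator `1_S` gives `1_{S ∖ x}` (for `x ∉ S` both
sides are `1_S`). [folklore] -/
theorem cb2po_update_ind_erase (S : Finset Λ) (x : Λ) :
    Function.update (fun z => if z ∈ S then (0 : Fin 2) else 1) x 1 =
      fun z => if z ∈ S.erase x then (0 : Fin 2) else 1 := by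
  funext z
  by_cases hz : z = x
  · subst hz
    simp
  · rw [Function.update_of_ne hz]
    simp [Finset.mem_erase, hz]

variable [Fintype Λ]

/-- **The Penrose–Onsager vector on occupation indicators**: for
`Φ = A†ψ : σ ↦ Σ_{x : σ_x = 0} ψ(σ with x emptied)`, `Φ(1_S) = Σ_{u ∈ S} ψ(1_{S ∖ u})`.
Penrose–Onsager, Phys. Rev. 104 (1956) 576, eq. (33) (the trial function `a₀†Ψ_{N-1}`). [folklore] -/
theorem cb2po_poVec_ind (ψ Φ : TensorIndex Λ 2 → ℂ)
    (hΦ : ∀ σ, Φ σ = ∑ x, if σ x = 0 then ψ (Function.update σ x 1) else 0) (S : Finset Λ) :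
    Φ (fun z => if z ∈ S then (0 : Fin 2) else 1) =
      ∑ u ∈ S, ψ (fun z => if z ∈ S.erase u then (0 : Fin 2) else 1) := by
  have h : ∀ u : Λ, (if (if u ∈ S then (0 : Fin 2) else 1) = 0 then
      ψ (Function.update (fun z => if z ∈ S then (0 : Fin 2) else 1) u 1) else 0) =
      if u ∈ S then ψ (fun z => if z ∈ S.erase u then (0 : Fin 2) else 1) else 0 := by
    intro u
    rw [cb2po_update_ind_erase]
    by_cases hu : u ∈ S <;> simp [hu]
  rw [hΦ]
  exact (Finset.sum_congr rfl fun u _ => h u).trans (by rw [Finset.sum_ite_mem, Finset.univ_inter])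

/-- **One-particle decomposition (vector form).** For `x ∉ T`,
`Φ(1_{T ∪ x}) = ψ(1_T) + Σ_{z ∈ T} ψ(1_{(T ∖ z) ∪ x})`: the amplitude of the PO vector on `T ∪ x`
is the amplitude of `ψ` on the background plus the one-particle insertion amplitudes of `ψ` at `x`
over the deleted backgrounds `T ∖ z`. [folklore] -/
theorem cb2po_poVec_ind_insert (ψ Φ : TensorIndex Λ 2 → ℂ)
    (hΦ : ∀ σ, Φ σ = ∑ x, if σ x = 0 then ψ (Function.update σ x 1) else 0)
    (T : Finset Λ) {x : Λ} (hx : x ∉ T) :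
    Φ (fun z => if z ∈ insert x T then (0 : Fin 2) else 1) =
      ψ (fun z => if z ∈ T then (0 : Fin 2) else 1) +
        ∑ z ∈ T, ψ (fun w => if w ∈ insert x (T.erase z) then (0 : Fin 2) else 1) := by
  rw [cb2po_poVec_ind ψ Φ hΦ, Finset.sum_insert hx, Finset.erase_insert hx]
  congr 1
  refine Finset.sum_congr rfl fun z hz => ?_
  have hxz : x ≠ z := fun h => hx (h ▸ hz)
  rw [Finset.erase_insert_of_ne hxz]

/-- **One-particle decomposition of the PO insertion field** (PO averaging, one-particle part):
for `x ∉ T`, `u^T[Φ]_x = Re ψ(1_T) + Σ_{z ∈ T} u^{T ∖ z}[ψ]_x` — a flat field plus the one-particle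
fields of `ψ` on the deleted backgrounds (each written exactly as the one-particle field
`[x ∉ T'] Re ψ(1_{T' ∪ x})` at `T' = T ∖ z`). [folklore] -/
theorem cb2po_field1_poVec (ψ Φ : TensorIndex Λ 2 → ℂ)
    (hΦ : ∀ σ, Φ σ = ∑ x, if σ x = 0 then ψ (Function.update σ x 1) else 0)
    (T : Finset Λ) {x : Λ} (hx : x ∉ T) :
    (Φ (fun z => if z ∈ insert x T then (0 : Fin 2) else 1)).re =
      (ψ (fun z => if z ∈ T then (0 : Fin 2) else 1)).re +
        ∑ z ∈ T, (if x ∉ T.erase z then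
          (ψ (fun w => if w ∈ insert x (T.erase z) then (0 : Fin 2) else 1)).re else 0) := by
  rw [cb2po_poVec_ind_insert ψ Φ hΦ T hx, Complex.add_re, Complex.re_sum]
  congr 1
  refine Finset.sum_congr rfl fun z _ => ?_
  rw [if_pos fun h => hx (Finset.mem_of_mem_erase h)]

/-- **Two-particle decomposition of the PO insertion field** (PO averaging, card (B4)): for
`x ∉ T`,
`r^T[Φ]_x = (Σ_y u^T[ψ]_y) + (|Λ| - 2|T| - 2) · u^T[ψ]_x + Σ_{z ∈ T} r^{T ∖ z}[ψ]_x`,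
where `u^T[ψ]_y = [y ∉ T] Re ψ(1_{T ∪ y})` is the one-particle field and `r^{T'}[ψ] = field ψ T'` the
two-particle field of `ψ`. (Expand `Φ(1_{T ∪ {x,y}}) = ψ(1_{T ∪ y}) + ψ(1_{T ∪ x}) + Σ_{z∈T} ψ(1_{(T∖z) ∪ {x,y}})`
and resum over `y`; the `y = z` summand of `r^{T∖z}[ψ]_x` is `Re ψ(1_{T ∪ x})`.) An unconditional
finite identity; at `|T| = N - 1`, `|Λ| = L³` the flat coefficient is `L³ - 2N`. [folklore] -/
theorem cb2po_field_poVec (ψ Φ : TensorIndex Λ 2 → ℂ)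
    (hΦ : ∀ σ, Φ σ = ∑ x, if σ x = 0 then ψ (Function.update σ x 1) else 0)
    (T : Finset Λ) {x : Λ} (hx : x ∉ T) :
    field Φ T x =
      (∑ y, (if y ∉ T then (ψ (fun z => if z ∈ insert y T then (0 : Fin 2) else 1)).re else 0)) +
      ((Fintype.card Λ : ℝ) - 2 * T.card - 2) *
        (ψ (fun z => if z ∈ insert x T then (0 : Fin 2) else 1)).re +
      ∑ z ∈ T, field ψ (T.erase z) x := by
  set a : Finset Λ → ℝ := fun S => (ψ (fun z => if z ∈ S then (0 : Fin 2) else 1)).re with ha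
  -- (1) `Φ` on the sets `T ∪ {x, y}`
  have hexp : ∀ y, y ∉ T → x ≠ y →
      (Φ (fun z => if z ∈ insert x (insert y T) then (0 : Fin 2) else 1)).re =
        a (insert y T) + a (insert x T) + ∑ z ∈ T, a (insert x (insert y (T.erase z))) := by
    intro y hy hxy
    have hx' : x ∉ insert y T := by simp [hxy, hx]
    rw [cb2po_poVec_ind ψ Φ hΦ, Finset.sum_insert hx', Finset.sum_insert hy,
      Finset.erase_insert hx', Finset.erase_insert_of_ne hxy, Finset.erase_insert hy,
      Complex.add_re, Complex.add_re, Complex.re_sum, ← add_assoc]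
    congr 1
    refine Finset.sum_congr rfl fun z hz => ?_
    have hxz : x ≠ z := fun h => hx (h ▸ hz)
    have hyz : y ≠ z := fun h => hy (h ▸ hz)
    rw [Finset.erase_insert_of_ne hxz, Finset.erase_insert_of_ne hyz]
  -- (2) the summand of `field Φ T x`, split into its three parts
  have hsummand : ∀ y, (if x ∉ T ∧ y ∉ T ∧ x ≠ y then
      (Φ (fun z => if z ∈ insert x (insert y T) then (0 : Fin 2) else 1)).re else 0) =
      (if y ∉ T ∧ x ≠ y then a (insert y T) else 0) +
      (if y ∉ T ∧ x ≠ y then a (insert x T) else 0) +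
      ∑ z ∈ T, (if y ∉ T ∧ x ≠ y then a (insert x (insert y (T.erase z))) else 0) := by
    intro y
    by_cases hc : y ∉ T ∧ x ≠ y
    · rw [if_pos ⟨hx, hc⟩, if_pos hc, if_pos hc, hexp y hc.1 hc.2]
      congr 1
      exact Finset.sum_congr rfl fun z _ => (if_pos hc).symm
    · rw [if_neg (fun h => hc h.2), if_neg hc, if_neg hc]
      rw [Finset.sum_congr rfl fun z _ => if_neg hc, Finset.sum_const_zero]
      ring
  have h0 : field Φ T x =
      (∑ y, (if y ∉ T ∧ x ≠ y then a (insert y T) else 0)) +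
      (∑ y, (if y ∉ T ∧ x ≠ y then a (insert x T) else 0)) +
      ∑ y, ∑ z ∈ T, (if y ∉ T ∧ x ≠ y then a (insert x (insert y (T.erase z))) else 0) := by
    rw [field, Finset.sum_congr rfl fun y _ => hsummand y, Finset.sum_add_distrib,
      Finset.sum_add_distrib]
  -- (3a) first part: all one-particle amplitudes but the one at `x`
  have h1 : (∑ y, (if y ∉ T ∧ x ≠ y then a (insert y T) else 0)) + a (insert x T) =
      ∑ y, (if y ∉ T then a (insert y T) else 0) := by
    rw [← Finset.add_sum_erase _ _ (Finset.mem_univ x),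
      ← Finset.add_sum_erase _ (fun y => if y ∉ T then a (insert y T) else 0) (Finset.mem_univ x),
      if_neg (fun h => h.2 rfl), if_pos hx, zero_add, add_comm]
    congr 1
    refine Finset.sum_congr rfl fun y hy => ?_
    have hyx : y ≠ x := Finset.ne_of_mem_erase hy
    by_cases hyT : y ∈ T
    · rw [if_neg (fun h => h.1 hyT), if_neg (fun h => h hyT)]
    · rw [if_pos ⟨hyT, fun h => hyx h.symm⟩, if_pos hyT]
  -- (3b) second part: a constant summed over `(T ∪ x)ᶜ`
  have h2 : (∑ y, (if y ∉ T ∧ x ≠ y then a (insert x T) else 0)) =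
      ((Fintype.card Λ : ℝ) - T.card - 1) * a (insert x T) := by
    have hfilter : (Finset.univ.filter fun y => y ∉ T ∧ x ≠ y) = (insert x T)ᶜ := by
      ext y
      simp only [Finset.mem_filter, Finset.mem_univ, true_and, Finset.mem_compl,
        Finset.mem_insert, not_or]
      exact ⟨fun h => ⟨fun h' => h.2 h'.symm, h.1⟩, fun h => ⟨h.2, fun h' => h.1 h'.symm⟩⟩
    rw [← Finset.sum_filter, hfilter, Finset.sum_const, nsmul_eq_mul, Finset.card_compl,
      Finset.card_insert_of_notMem hx, Nat.cast_sub, Nat.cast_add, Nat.cast_one]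
    · ring
    · rw [← Finset.card_insert_of_notMem hx]
      exact Finset.card_le_univ _
  -- (3c) third part: the two-particle fields on the deleted backgrounds, minus their `y = z` term
  have h3 : ∀ z ∈ T, (∑ y, (if y ∉ T ∧ x ≠ y then a (insert x (insert y (T.erase z))) else 0)) +
      a (insert x T) = field ψ (T.erase z) x := by
    intro z hz
    have hxz : x ≠ z := fun h => hx (h ▸ hz)
    rw [field, ← Finset.add_sum_erase _ _ (Finset.mem_univ z),
      ← Finset.add_sum_erase _ (fun y => if x ∉ T.erase z ∧ y ∉ T.erase z ∧ x ≠ y then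
        (ψ (fun w => if w ∈ insert x (insert y (T.erase z)) then (0 : Fin 2) else 1)).re else 0)
        (Finset.mem_univ z),
      if_neg (fun h => h.1 hz), zero_add, add_comm,
      if_pos ⟨fun h => hx (Finset.mem_of_mem_erase h), Finset.notMem_erase z T, hxz⟩,
      Finset.insert_erase hz]
    congr 1
    refine Finset.sum_congr rfl fun y hy => ?_
    have hyz : y ≠ z := Finset.ne_of_mem_erase hy
    have hiff : (y ∉ T ∧ x ≠ y) ↔ (x ∉ T.erase z ∧ y ∉ T.erase z ∧ x ≠ y) := by
      simp only [Finset.mem_erase, not_and]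
      exact ⟨fun h => ⟨fun _ => hx, fun _ => h.1, h.2⟩, fun h => ⟨h.2.1 hyz, h.2.2⟩⟩
    exact if_congr hiff rfl rfl
  have h3' : (∑ y, ∑ z ∈ T, (if y ∉ T ∧ x ≠ y then a (insert x (insert y (T.erase z))) else 0)) +
      (T.card : ℝ) * a (insert x T) = ∑ z ∈ T, field ψ (T.erase z) x := by
    rw [Finset.sum_comm, ← Finset.sum_congr rfl h3, Finset.sum_add_distrib, Finset.sum_const,
      nsmul_eq_mul]
  rw [h0]
  linear_combination h1 + h2 + h3'

/-- The PO vector of an entrywise real nonnegative vector is entrywise real nonnegative. [folklore] -/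
theorem cb2po_poVec_nonneg (ψ Φ : TensorIndex Λ 2 → ℂ)
    (hΦ : ∀ σ, Φ σ = ∑ x, if σ x = 0 then ψ (Function.update σ x 1) else 0)
    (hnn : ∀ σ, 0 ≤ (ψ σ).re ∧ (ψ σ).im = 0) : ∀ σ, 0 ≤ (Φ σ).re ∧ (Φ σ).im = 0 := by
  intro σ
  rw [hΦ, Complex.re_sum, Complex.im_sum]
  refine ⟨Finset.sum_nonneg fun x _ => ?_, Finset.sum_eq_zero fun x _ => ?_⟩
  · split_ifs
    · exact (hnn _).1
    · simp
  · split_ifs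
    · exact (hnn _).2
    · simp

end Bookkeeping

section Jensen

variable {ι κ : Type*} [Fintype ι]

/-- **Jensen bound for the flatness functional of a positive mixture.** For nonnegative fields
`r_k` (`k ∈ s`) with masses `m_k = Σ_x r_k(x)` and `R = Σ_k r_k` of mass `S = Σ_k m_k`,
`K1lhs R ≤ Σ_k (S/m_k) · K1lhs r_k`,
i.e. `Σ R³/S + (Σ R²)²/S² ≤ Σ_k (S/m_k)(Σ r_k³/m_k + (Σ r_k²)²/m_k²)`: Jensen for `t ↦ t³` and
`t ↦ t²` with the mass fractions `m_k/S` as weights (`R = Σ_k (m_k/S)(S r_k/m_k)`), plus the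
subadditivity `‖R‖²/S ≤ Σ_k ‖r_k‖²/m_k`; equality when the components are parallel. Components of
mass zero vanish and contribute `0` on the right (`x/0 = 0`). [folklore] -/
theorem cb2po_K1lhs_mixture_le (s : Finset κ) (r : κ → ι → ℝ) (hr : ∀ k ∈ s, ∀ x, 0 ≤ r k x)
    (R : ι → ℝ) (hR : ∀ x, R x = ∑ k ∈ s, r k x) :
    K1lhs R ≤ ∑ k ∈ s, (∑ x, R x) / (∑ x, r k x) * K1lhs (r k) := by
  classical
  set m : κ → ℝ := fun k => ∑ x, r k x with hm
  set S : ℝ := ∑ x, R x with hSdef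
  have hm0 : ∀ k ∈ s, 0 ≤ m k := fun k hk => Finset.sum_nonneg fun x _ => hr k hk x
  have hzero : ∀ k ∈ s, m k = 0 → ∀ x, r k x = 0 := fun k hk h x =>
    (Finset.sum_eq_zero_iff_of_nonneg fun x _ => hr k hk x).1 h x (Finset.mem_univ x)
  have hR0 : ∀ x, 0 ≤ R x := fun x => by
    rw [hR x]
    exact Finset.sum_nonneg fun k hk => hr k hk x
  -- the components of positive mass
  set s' := s.filter fun k => m k ≠ 0 with hs'
  have hsub : ∀ k ∈ s', k ∈ s := fun k hk => (Finset.mem_filter.1 hk).1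
  have hmpos : ∀ k ∈ s', 0 < m k := fun k hk =>
    lt_of_le_of_ne (hm0 k (hsub k hk)) (Ne.symm (Finset.mem_filter.1 hk).2)
  have hR' : ∀ x, R x = ∑ k ∈ s', r k x := by
    intro x
    rw [hR, hs', Finset.sum_filter]
    refine Finset.sum_congr rfl fun k hk => ?_
    by_cases h : m k ≠ 0
    · rw [if_pos h]
    · rw [if_neg h, hzero k hk (not_not.1 h) x]
  have hS' : S = ∑ k ∈ s', m k := by
    rw [hSdef, Finset.sum_congr rfl fun x _ => hR' x, Finset.sum_comm]
  have hRHS : ∑ k ∈ s, S / m k * K1lhs (r k) = ∑ k ∈ s', S / m k * K1lhs (r k) := by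
    rw [hs', Finset.sum_filter]
    refine Finset.sum_congr rfl fun k _ => ?_
    by_cases h : m k ≠ 0
    · rw [if_pos h]
    · rw [if_neg h, not_not.1 h, div_zero, zero_mul]
  rw [hRHS]
  by_cases hS0 : S = 0
  · -- the zero field
    have hRz : ∀ x, R x = 0 := fun x =>
      (Finset.sum_eq_zero_iff_of_nonneg fun y _ => hR0 y).1 hS0 x (Finset.mem_univ x)
    have hl : K1lhs R = 0 := by
      simp [K1lhs, hRz]
    rw [hl]
    exact Finset.sum_nonneg fun k hk => mul_nonneg (by rw [hS0, zero_div])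
      (add_nonneg (div_nonneg (Finset.sum_nonneg fun x _ => pow_nonneg (hr k (hsub k hk) x) 3)
        (hmpos k hk).le) (div_nonneg (sq_nonneg _) (sq_nonneg _)))
  have hSpos : 0 < S := lt_of_le_of_ne (Finset.sum_nonneg fun x _ => hR0 x) (Ne.symm hS0)
  -- mass fractions as Jensen weights
  have hw0 : ∀ k ∈ s', 0 ≤ m k / S := fun k hk => div_nonneg (hmpos k hk).le hSpos.le
  have hw1 : ∑ k ∈ s', m k / S = 1 := by
    rw [← Finset.sum_div, ← hS', div_self hS0]
  -- (a) the cubic term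
  have hcube : ∀ x, R x ^ 3 ≤ S ^ 2 * ∑ k ∈ s', r k x ^ 3 / m k ^ 2 := by
    intro x
    have h := Real.pow_arith_mean_le_arith_mean_pow s' (fun k => m k / S)
      (fun k => S * r k x / m k) hw0 hw1 (fun k hk => by
        have := hmpos k hk
        have := hr k (hsub k hk) x
        positivity) 3
    have hl : ∑ k ∈ s', m k / S * (S * r k x / m k) = R x := by
      rw [hR' x]
      refine Finset.sum_congr rfl fun k hk => ?_
      field_simp [(hmpos k hk).ne']
    have hr' : ∑ k ∈ s', m k / S * (S * r k x / m k) ^ 3 =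
        S ^ 2 * ∑ k ∈ s', r k x ^ 3 / m k ^ 2 := by
      rw [Finset.mul_sum]
      refine Finset.sum_congr rfl fun k hk => ?_
      field_simp [(hmpos k hk).ne']
    rwa [hl, hr'] at h
  have hA : (∑ x, R x ^ 3) / S ≤ ∑ k ∈ s', S / m k * ((∑ x, r k x ^ 3) / m k) := by
    rw [div_le_iff₀ hSpos]
    calc ∑ x, R x ^ 3 ≤ ∑ x, S ^ 2 * ∑ k ∈ s', r k x ^ 3 / m k ^ 2 :=
          Finset.sum_le_sum fun x _ => hcube x
      _ = (∑ k ∈ s', S / m k * ((∑ x, r k x ^ 3) / m k)) * S := by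
          rw [← Finset.mul_sum, Finset.sum_comm, Finset.sum_mul, Finset.mul_sum]
          refine Finset.sum_congr rfl fun k hk => ?_
          rw [← Finset.sum_div]
          field_simp [(hmpos k hk).ne']
  -- (b) the quadratic term: `‖R‖²/S ≤ Σ_k ‖r_k‖²/m_k`, then Jensen once more
  have hsq : ∀ x, R x ^ 2 ≤ S * ∑ k ∈ s', r k x ^ 2 / m k := by
    intro x
    have h := Real.pow_arith_mean_le_arith_mean_pow s' (fun k => m k / S)
      (fun k => S * r k x / m k) hw0 hw1 (fun k hk => by
        have := hmpos k hk
        have := hr k (hsub k hk) x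
        positivity) 2
    have hl : ∑ k ∈ s', m k / S * (S * r k x / m k) = R x := by
      rw [hR' x]
      refine Finset.sum_congr rfl fun k hk => ?_
      field_simp [(hmpos k hk).ne']
    have hr' : ∑ k ∈ s', m k / S * (S * r k x / m k) ^ 2 = S * ∑ k ∈ s', r k x ^ 2 / m k := by
      rw [Finset.mul_sum]
      refine Finset.sum_congr rfl fun k hk => ?_
      field_simp [(hmpos k hk).ne']
    rwa [hl, hr'] at h
  have hβ : (∑ x, R x ^ 2) / S ≤ ∑ k ∈ s', (∑ x, r k x ^ 2) / m k := by
    rw [div_le_iff₀ hSpos]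
    calc ∑ x, R x ^ 2 ≤ ∑ x, S * ∑ k ∈ s', r k x ^ 2 / m k :=
          Finset.sum_le_sum fun x _ => hsq x
      _ = (∑ k ∈ s', (∑ x, r k x ^ 2) / m k) * S := by
          rw [← Finset.mul_sum, Finset.sum_comm, mul_comm]
          congr 1
          refine Finset.sum_congr rfl fun k _ => ?_
          rw [Finset.sum_div]
  have hβsq : (∑ k ∈ s', (∑ x, r k x ^ 2) / m k) ^ 2 ≤
      ∑ k ∈ s', S / m k * ((∑ x, r k x ^ 2) ^ 2 / m k ^ 2) := by
    have h := Real.pow_arith_mean_le_arith_mean_pow s' (fun k => m k / S)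
      (fun k => S * (∑ x, r k x ^ 2) / m k ^ 2) hw0 hw1 (fun k hk => by
        have := hmpos k hk
        have : 0 ≤ ∑ x, r k x ^ 2 := Finset.sum_nonneg fun x _ => sq_nonneg _
        positivity) 2
    have hl : ∑ k ∈ s', m k / S * (S * (∑ x, r k x ^ 2) / m k ^ 2) =
        ∑ k ∈ s', (∑ x, r k x ^ 2) / m k := by
      refine Finset.sum_congr rfl fun k hk => ?_
      field_simp [(hmpos k hk).ne']
    have hr' : ∑ k ∈ s', m k / S * (S * (∑ x, r k x ^ 2) / m k ^ 2) ^ 2 =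
        ∑ k ∈ s', S / m k * ((∑ x, r k x ^ 2) ^ 2 / m k ^ 2) := by
      refine Finset.sum_congr rfl fun k hk => ?_
      field_simp [(hmpos k hk).ne']
    rwa [hl, hr'] at h
  have hB : (∑ x, R x ^ 2) ^ 2 / S ^ 2 ≤ ∑ k ∈ s', S / m k * ((∑ x, r k x ^ 2) ^ 2 / m k ^ 2) := by
    rw [← div_pow]
    exact (pow_le_pow_left₀ (div_nonneg (Finset.sum_nonneg fun x _ => sq_nonneg _) hSpos.le)
      hβ 2).trans hβsq
  -- assemble
  calc K1lhs R = (∑ x, R x ^ 3) / S + (∑ x, R x ^ 2) ^ 2 / S ^ 2 := rfl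
    _ ≤ ∑ k ∈ s', S / m k * ((∑ x, r k x ^ 3) / m k) +
        ∑ k ∈ s', S / m k * ((∑ x, r k x ^ 2) ^ 2 / m k ^ 2) := add_le_add hA hB
    _ = ∑ k ∈ s', S / m k * K1lhs (r k) := by
        rw [← Finset.sum_add_distrib]
        refine Finset.sum_congr rfl fun k _ => ?_
        rw [K1lhs]
        ring

end Jensen

section Torus

/-- **Registered sub-goal `stub_poAveragingDecomposition`** (helper of `stub_poAveraging`, line
`cosh-budget-penrose-onsager`): on the torus `(ℤ/Lℤ)³` (`|Λ| = L³`), for every vector `ψ'`, every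
background `T` and every `x ∉ T`, the one- and two-particle insertion fields of the PO vector
`Φ = A†ψ'` decompose as `u^T[Φ]_x = Re ψ'(1_T) + Σ_{z∈T} u^{T∖z}[ψ']_x` and
`r^T[Φ]_x = Σ_y u^T[ψ']_y + (L³ - 2|T| - 2) u^T[ψ']_x + Σ_{z∈T} r^{T∖z}[ψ']_x`
(`cb2po_field1_poVec`, `cb2po_field_poVec`). [folklore] -/
theorem stub_poAveragingDecomposition :
    ∀ (L : ℕ) [NeZero L] (ψ' : TensorIndex (TorusSite 3 L) 2 → ℂ) (T : Finset (TorusSite 3 L))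
      (x : TorusSite 3 L), x ∉ T →
      ((fun σ => ∑ x, if σ x = 0 then (ψ') (Function.update σ x 1) else 0)
          (fun z => if z ∈ insert x T then 0 else 1)).re =
        (ψ' (fun z => if z ∈ T then 0 else 1)).re +
          ∑ z ∈ T, (if x ∉ T.erase z then
            (ψ' (fun w => if w ∈ insert x (T.erase z) then 0 else 1)).re else 0) ∧
      field (fun σ => ∑ x, if σ x = 0 then (ψ') (Function.update σ x 1) else 0) T x =
        (∑ y, (if y ∉ T then (ψ' (fun z => if z ∈ insert y T then 0 else 1)).re else 0)) +
        ((L : ℝ) ^ 3 - 2 * T.card - 2) * (ψ' (fun z => if z ∈ insert x T then 0 else 1)).re +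
        ∑ z ∈ T, field ψ' (T.erase z) x := by
  intro L _ ψ' T x hx
  refine ⟨cb2po_field1_poVec ψ' _ (fun σ => rfl) T hx, ?_⟩
  rw [cb2po_field_poVec ψ' _ (fun σ => rfl) T hx, card_torusSite 3 L]
  push_cast
  ring

end Torus

end Summit.AtomisticToContinuum.BoseEinsteinCondensation.Cruxes.InsertionFieldDelocalisation.CoshBudgetPenroseOnsager

end
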